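import Summits.HodgeConjecture.CorCM.Model.CasimirClassAlgebraic
import Literature.AlgebraicGeometry.HodgeTheory.WeilTypeRationalDatum
import HarnessLib

/-!
# COR-CM model layer, row M22 `Fact_algDuality`, clause (i), input K-b′ in the shape of input R2:
# the Künneth–Casimir class of the rational polarisation form of a `(1,1)`-class is algebraic

Cell `pub-hodgecm2` (COR-CM), seat `b30`; sequel to `CorCM/Model/CasimirClassAlgebraic.lean` (p233036).  Row M22's
input R2 (a Rosati-balanced polarisation of the coded CM realisations / of their product; lit-milne
`ComplexMultiplication/RosatiPolarizationCM.lean`, b13/b26 junctions) arrives as a rational class `h ∈ H²(X(ℂ); ℂ)` that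
is algebraic (hence of type `(1,1)`) and a non-zero real multiple of a Kähler class, together with the Rosati identity for
the pairing `Q_h(x, y) = hʲ ⌣ x ⌣ y` on `H¹`.  The tree already packages `Q_h` on the RATIONAL lattice as the bilinear
form `ratPolarizationForm h hh j ℓ hℓ : LinearMap.BilinForm ℚ (bettiCohomology X 1)` (`HodgeTheory/WeilTypeRationalDatum`,
`ℓ` a functional rational on rational classes, e.g. `lineCoord ω₀`) and proves it nondegenerate for Kähler multiples
(`Deligne1982.nondegenerate_ratPolarizationForm_of_isKaehlerClass_smul`).  Here:

* `baseChange_ratPolarizationForm_apply` — the bridge `E_ℂ(x, y) = ℓ(Q_h(Θ x, Θ y))` between the complexified rational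
  form and `Q_h` (`Θ = ofRatClassBaseChange`);
* `baseChange_ratPolarizationForm_eq_zero_of_mem_F` — the Riemann condition `E_ℂ(F¹H¹, F¹H¹) = 0` for `h` of type
  `(1,1)` (`Q_h(H^{1,0}, H^{1,0}) = 0`, the tree's `polarizationPairingOne_eq_zero_of_mem_hodgeOneZero`);
* `casimirClass_ratPolarizationForm_mem_ratAlgebraicClasses` — hence, by `casimirClass_mem_ratAlgebraicClasses`, the
  Künneth–Casimir class `Σ_i fst^* u_i ∪ snd^* v_i` of `E = ratPolarizationForm h hh j ℓ hℓ` (any basis `v`, `u` its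
  `E`-dual basis) is a rational algebraic class of codimension one on `X × X`.

So a consumer (K-a / the M22 assembly) passes R2's `h` straight in; no `θ ∈ H²(X; ℚ)`, no `θ^g ≠ 0`, no identification
`H² = ⋀²H¹` and no multiplication map are needed for the algebraicity of the Poincaré class.  No defs, no named facts.

References: as in `CasimirClassAlgebraic.lean` (Lange 2023 Lemma 6.1.8, Prop. 6.2.20; Beauville 1983 Prop. 1); for `Q_h`:
B. van Geemen, *An introduction to the Hodge conjecture for abelian varieties*, LNM 1594 (1994) 4.8–4.9; P. Deligne, *Hodge
cycles on abelian varieties*, LNM 900 (1982), proof of Thm. 4.8 (a′).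
-/

noncomputable section

open scoped TensorProduct
open Module

namespace Summit.HodgeConjecture.CorCM.Model

/-! ### The polarisation form of a rational `(1,1)`-class (the shape in which input R2 arrives) -/

section Polarization

open CategoryTheory MonoidalCategory
open Literature.AlgebraicTopology.SingularHomology (singularCohomology)
open Literature.AlgebraicGeometry.Motives (SchemeOver ComplexPoints IsSmoothProjective bettiCohomology
  polarizationPairingOne ofRatClassBaseChange ofRatClassBaseChange_tmul)
open Literature.AlgebraicGeometry.HodgeTheory
open Literature.NumberTheory.Automorphic.PicardCM (ratAlgebraicClasses)

variable {j : ℕ} {X : SchemeOver ℂ}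

/-- **Bridge**: the complexification of the tree's rational polarisation form `E = ratPolarizationForm h hh j ℓ hℓ`
(`(E(x, y) : ℂ) = ℓ(Q_h(x ⊗ 1, y ⊗ 1))`) is `ℓ ∘ Q_h` read through the complexification map
`Θ : ℂ ⊗_ℚ H¹(X(ℂ); ℚ) → H¹(X(ℂ); ℂ)`: `E_ℂ(x, y) = ℓ(Q_h(Θ x, Θ y))`. -/
theorem baseChange_ratPolarizationForm_apply (h : complexBetti X 2) (hh : IsRationalClass h)
    (ℓ : complexBetti X (2 + 2 * j) →ₗ[ℂ] ℂ)
    (hℓ : ∀ c : complexBetti X (2 + 2 * j), IsRationalClass c → ∃ q : ℚ, ℓ c = q)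
    (x y : ℂ ⊗[ℚ] bettiCohomology X 1) :
    (ratPolarizationForm h hh j ℓ hℓ).baseChange ℂ x y =
      ℓ (polarizationPairingOne X h j (ofRatClassBaseChange (ComplexPoints X) 1 x)
        (ofRatClassBaseChange (ComplexPoints X) 1 y)) := by
  induction x using TensorProduct.induction_on generalizing y with
  | zero => rw [LinearMap.map_zero₂, map_zero, LinearMap.map_zero₂, map_zero]
  | tmul a m =>
    induction y using TensorProduct.induction_on with
    | zero => rw [map_zero, map_zero, map_zero, map_zero]
    | tmul a' m' =>
      rw [LinearMap.BilinForm.baseChange_tmul, ofRatClassBaseChange_tmul, ofRatClassBaseChange_tmul,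
        LinearMap.map_smul₂, map_smul, map_smul, map_smul, ← ratPolarizationForm_spec h hh j ℓ hℓ, smul_eq_mul,
        smul_eq_mul, Rat.smul_def]
      ring
    | add y y' hy hy' => rw [map_add, hy, hy', map_add, map_add, map_add]
  | add x x' hx hx' =>
    rw [LinearMap.map_add₂, hx, hx', map_add, LinearMap.map_add₂, map_add]

/-- **The Riemann condition for a polarisation form**: for `h` of type `(1,1)` on a smooth projective `X` of dimension
`j + 1`, the complexified rational polarisation form `E = ratPolarizationForm h hh j ℓ hℓ` kills `F¹H¹ × F¹H¹`
(`Q_h(H^{1,0}, H^{1,0}) = 0` by Hodge type, the tree's `polarizationPairingOne_eq_zero_of_mem_hodgeOneZero`; `F¹` of the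
model's `BettiUniverse.hodge` maps into `H^{1,0}` under `Θ`, `BettiUniverse.isOfHodgeType_of_mem_F_self`). -/
theorem baseChange_ratPolarizationForm_eq_zero_of_mem_F (hHD : exists_isReal_hodgeModel)
    (hX : IsSmoothProjective (j + 1) X) (h : complexBetti X 2) (hh : IsRationalClass h)
    (h11 : IsOfHodgeType (j + 1) X 2 1 1 h) (ℓ : complexBetti X (2 + 2 * j) →ₗ[ℂ] ℂ)
    (hℓ : ∀ c : complexBetti X (2 + 2 * j), IsRationalClass c → ∃ q : ℚ, ℓ c = q)
    (x : ℂ ⊗[ℚ] bettiCohomology X 1) (hx : x ∈ (BettiUniverse.hodge hHD hX 1).F 1)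
    (y : ℂ ⊗[ℚ] bettiCohomology X 1) (hy : y ∈ (BettiUniverse.hodge hHD hX 1).F 1) :
    (ratPolarizationForm h hh j ℓ hℓ).baseChange ℂ x y = 0 := by
  rw [baseChange_ratPolarizationForm_apply,
    polarizationPairingOne_eq_zero_of_mem_hodgeOneZero hX h11
      ((mem_hodgeOneZero hX).2 (BettiUniverse.isOfHodgeType_of_mem_F_self hHD hX 1 hx))
      ((mem_hodgeOneZero hX).2 (BettiUniverse.isOfHodgeType_of_mem_F_self hHD hX 1 hy)),
    map_zero]

/-- **K-b′ in the shape of input R2.** Let `X/ℂ` be smooth projective of dimension `j + 1`, `h ∈ H²(X(ℂ); ℂ)` a rational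
class of type `(1,1)` (e.g. an algebraic class, `isOfHodgeType_of_mem_algebraicClasses_of_isSmoothProjective`), `ℓ` a
functional on `H^{2j+2}(X(ℂ); ℂ)` rational on rational classes (e.g. `lineCoord ω₀`, `lineCoord_ratValued`), and suppose
the rational polarisation form `E = ratPolarizationForm h hh j ℓ hℓ` on `H¹(X(ℂ); ℚ)` is nondegenerate (for `h` a
non-zero real multiple of a Kähler class: `Deligne1982.nondegenerate_ratPolarizationForm_of_isKaehlerClass_smul`).  Then
for every basis `v` of `H¹(X(ℂ); ℚ)` with `E`-dual basis `u` the Künneth–Casimir class `Σ_i fst^* u_i ∪ snd^* v_i` is a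
rational algebraic class of codimension one on `X × X`. -/
theorem casimirClass_ratPolarizationForm_mem_ratAlgebraicClasses (hHD : exists_isReal_hodgeModel)
    (hI : hodgePQ_independent_of_hodgeModel) (hX : IsSmoothProjective (j + 1) X) (h : complexBetti X 2)
    (hh : IsRationalClass h) (h11 : IsOfHodgeType (j + 1) X 2 1 1 h) (ℓ : complexBetti X (2 + 2 * j) →ₗ[ℂ] ℂ)
    (hℓ : ∀ c : complexBetti X (2 + 2 * j), IsRationalClass c → ∃ q : ℚ, ℓ c = q)
    (hE : (ratPolarizationForm h hh j ℓ hℓ).Nondegenerate)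
    {ι : Type*} [DecidableEq ι] [Fintype ι] (v : Basis ι ℚ (bettiCohomology X 1)) :
    (∑ i, BettiUniverse.cup (X ⊗ X) 1 1
        (BettiUniverse.pull (CartesianMonoidalCategory.fst X X) 1
          ((ratPolarizationForm h hh j ℓ hℓ).dualBasis hE v i))
        (BettiUniverse.pull (CartesianMonoidalCategory.snd X X) 1 (v i))) ∈
      ratAlgebraicClasses (X ⊗ X) 1 :=
  casimirClass_mem_ratAlgebraicClasses hHD hI hX _ hE
    (baseChange_ratPolarizationForm_eq_zero_of_mem_F hHD hX h hh h11 ℓ hℓ) v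

end Polarization

end Summit.HodgeConjecture.CorCM.Model

end
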